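import Mathlib
import HarnessLib
import Summits.Ventures.LatticeQCDFlow.Scoring.BatchMeans
import Summits.Ventures.LatticeQCDFlow.Scoring.ChainTimeAverage
import Summits.Ventures.LatticeQCDFlow.Scoring.IndepMHKernelPositive

/-!
# The binned (batch-means) error bar OF THE SIMULATED CHAIN: exact bias along `Kernel.trajMeasure`,
# anti-conservative at EVERY bin size for positive kernels — in particular for the exact
# independence-Metropolis flow sampler — and a certified bias under a Doeblin minorisation

HONEST FRAMING: exact (Metropolis-corrected) sampling algorithms for lattice gauge theory;
figures of merit are autocorrelation/cost numbers at stated couplings and volumes; no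
continuum-physics claim.

Venture `LatticeQCDFlow` (cell pub-lqcd), topic `Scoring`; FANOUT row 3 (`s0-u1-a`, S0-B
implementation A, GEN-4), whose sampler IS the independence Metropolis–Hastings kernel
`Exactness.indepMH q w` (propose from the trained flow's law `q`, accept with `min(1, w y / w x)`,
target `π = w · q`) and whose chain notes carry a binned error battery beside the Γ-method cells of
record.  NEW WORK of the cell, not a published result; NO definition is introduced.  This is the
chain instance announced in the docstring of row 8's population statement
`Scoring/BatchMeans.lean` (`integral_batchSEsq_eq`, `integral_batchSEsq_le_variance`,
`abs_integral_batchSEsq_sub_variance_le` — any square-integrable window with lag-only covariances),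
obtained through row 8's bridge `Scoring/ChainTimeAverage.lean` (`chain_covariance`,
`chain_marginal`, `chain_memLp`: the coordinates of Mathlib's `Kernel.trajMeasure` started in an
invariant law have equal means and covariances `autocov κ π (f − πf) |i − j|`), row 8's positivity
of the flow-MCMC kernel `Scoring/IndepMHKernelPositive.lean` (`indepMH_autocov_nonneg`) and row 8's
Doeblin envelope `Scoring/DoeblinAutocorrelation.lean` (`abs_acf_le_of_doeblin`).  Printed
counterparts NAMED ONLY, nothing cited as a fact: the bias of non-overlapping batch means
(Flegal–Jones, Ann. Statist. 38 (2010) 1034); positivity of the independence sampler (Liu,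
Statist. Comput. 6 (1996) 113).

## Content (`κ` a Markov kernel with invariant probability law `π`; `P` = `Kernel.trajMeasure`
## of the chain started in `π`; `f` bounded measurable; `X_n = f(ω n)`; `a ≥ 2` batches of
## length `b ≥ 1`; `σ² = Var_π f = autocov κ π (f − πf) 0`, `ρ(t) = autocov κ π (f − πf) t / σ²`,
## `τ_n = Scoring.tauIntN ρ n`; `SE²_BM = replicaSEsq` of the `a` batch means)

* `autocov_sq_le_sq`, `autocov_eq_zero_of_autocov_zero` — stationarity bounds every lag by lag
  zero: `C_g(t)² ≤ C_g(0)²` (Cauchy–Schwarz and the `L²(π)` contraction of `kop κ`), so a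
  `π`-trivial observable has ALL autocovariances zero (the degenerate case below);
* **`chain_integral_batchSEsq_eq`** — THE IDENTITY ALONG THE CHAIN (`σ² ≠ 0`):
  `E_P[SE²_BM] = Var_P(x̄_{ab}) − (2σ²/(b(a−1))) (τ_{ab} − τ_b)`;
* **`chain_integral_batchSEsq_le_variance`** — if `autocov κ π (f − πf) t ≥ 0` for every `t`
  (a positive kernel), then `E_P[SE²_BM] ≤ Var_P(x̄_{ab})` for EVERY `a ≥ 2`, `b ≥ 1`: the binned
  error bar under-covers in expectation at every bin length, not only for bins shorter than the
  autocorrelation time (the shortfall is the identity's `(2σ²/(b(a−1))) (τ_{ab} − τ_b) ≥ 0`, large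
  exactly when `τ_b ≪ τ_{ab}`);
* **`indepMH_chain_integral_batchSEsq_le_variance`** — THE FLOW-SAMPLER INSTANCE: for
  `κ = indepMH q w` with `w · q = π` the positivity hypothesis is a theorem
  (`indepMH_autocov_nonneg`), so the conclusion holds for every bounded measurable observable,
  every trained model `q`, every `a ≥ 2`, `b ≥ 1`, with no further hypothesis;
* **`chain_abs_integral_batchSEsq_sub_variance_le_of_doeblin`** — CERTIFIED BIAS: if
  `κ(x, ·) ≥ ε π` with `0 < ε` then
  `|E_P[SE²_BM] − Var_P(x̄_{ab})| ≤ (2σ²/(b(a−1))) ((1−ε)/(b ε²) + (1−ε)^{b+1}/ε)`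
  (row 8's envelope `|ρ(t)| ≤ (1 − ε)ᵗ` fed to `abs_integral_batchSEsq_sub_variance_le` with
  `M = 1`, `r = 1 − ε`): honest once `b ≫ 1/ε²`.

NOT CLAIMED: the sampling scatter of `SE²_BM` (only its expectation is controlled); overlapping
batch means or the Γ-method window rule (the cells of record are Γ-method readings); anything for
non-positive kernels beyond the Doeblin statement (heat bath / HMC comparators); non-stationary
starts; any number of ours.
-/

noncomputable section

namespace Summit.Ventures.LatticeQCDFlow.Scoring

open MeasureTheory ProbabilityTheory Filter Finset Summit.Ventures.LatticeQCDFlow.Exactness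
open scoped ENNReal

variable {Ω : Type*} [MeasurableSpace Ω]

/-! ### Every lag is bounded by lag zero -/

section Stationary

variable {κ : Kernel Ω Ω} [IsMarkovKernel κ] {π : Measure Ω} [IsProbabilityMeasure π]

/-- **`C_g(t)² ≤ C_g(0)²`** for every bounded measurable `g` and every lag `t`, when `π` is
invariant: Cauchy–Schwarz in `L²(π)` and `∫ ((kop κ)^[t] g)² dπ ≤ ∫ g² dπ`. -/
theorem autocov_sq_le_sq (hπ : Kernel.Invariant κ π) {g : Ω → ℝ} (hg : Measurable g) {C : ℝ}
    (hC : ∀ x, |g x| ≤ C) (t : ℕ) :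
    autocov κ π g t ^ 2 ≤ autocov κ π g 0 ^ 2 := by
  obtain ⟨hm, hb⟩ := iterate_kop_bounded_measurable κ hg hC t
  have h1 : (∫ x, g x * (kop κ)^[t] g x ∂π) ^ 2
      ≤ (∫ x, g x ^ 2 ∂π) * ∫ x, ((kop κ)^[t] g x) ^ 2 ∂π :=
    sq_integral_mul_le π hg hm hC hb
  have h2 : ∫ x, ((kop κ)^[t] g x) ^ 2 ∂π ≤ ∫ x, g x ^ 2 ∂π :=
    integral_sq_iterate_kop_le κ hπ hg hC t
  have h0 : 0 ≤ ∫ x, g x ^ 2 ∂π := integral_nonneg fun x => sq_nonneg _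
  rw [autocov_zero]
  calc autocov κ π g t ^ 2 = (∫ x, g x * (kop κ)^[t] g x ∂π) ^ 2 := rfl
    _ ≤ (∫ x, g x ^ 2 ∂π) * ∫ x, ((kop κ)^[t] g x) ^ 2 ∂π := h1
    _ ≤ (∫ x, g x ^ 2 ∂π) * ∫ x, g x ^ 2 ∂π := mul_le_mul_of_nonneg_left h2 h0
    _ = (∫ x, g x ^ 2 ∂π) ^ 2 := (sq _).symm

/-- **Degenerate observables**: if `C_g(0) = ∫ g² dπ = 0` then `C_g(t) = 0` at every lag. -/
theorem autocov_eq_zero_of_autocov_zero (hπ : Kernel.Invariant κ π) {g : Ω → ℝ}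
    (hg : Measurable g) {C : ℝ} (hC : ∀ x, |g x| ≤ C) (h0 : autocov κ π g 0 = 0) (t : ℕ) :
    autocov κ π g t = 0 := by
  have h := autocov_sq_le_sq hπ hg hC t
  rw [h0, zero_pow two_ne_zero] at h
  exact (pow_eq_zero_iff two_ne_zero).1 (le_antisymm h (sq_nonneg _))

end Stationary

/-! ### Batch means along the simulated chain -/

section Chain

variable {κ : Kernel Ω Ω} [IsMarkovKernel κ] {π : Measure Ω} [IsProbabilityMeasure π]

/-- **THE IDENTITY ALONG THE CHAIN.**  For the chain with kernel `κ` started in its invariant law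
`π`, a bounded measurable `f` with `σ² = Var_π f ≠ 0`, `a ≥ 2` batches of length `b ≥ 1`:
`E[SE²_BM] = Var(x̄_{ab}) − (2σ²/(b(a−1))) (τ_{ab} − τ_b)` with `ρ(t) = autocov κ π (f − πf) t / σ²`
the TRUE autocorrelation function and `τ_n = tauIntN ρ n`. -/
theorem chain_integral_batchSEsq_eq (hπ : Kernel.Invariant κ π) {f : Ω → ℝ} (hf : Measurable f)
    {C : ℝ} (hC : ∀ x, |f x| ≤ C)
    (hvar : autocov κ π (fun y => f y - ∫ z, f z ∂π) 0 ≠ 0) {a b : ℕ} (ha : 2 ≤ a) (hb : b ≠ 0) :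
    ∫ x, replicaSEsq (fun j (x : ℕ → Ω) => (∑ i ∈ range b, f (x (b * j + i))) / b) a x
        ∂(Kernel.trajMeasure (X := fun _ : ℕ => Ω) π
          (fun n : ℕ => κ.comap (fun h : (i : ↥(Finset.Iic n)) → Ω => h ⟨n, Finset.mem_Iic.2 le_rfl⟩)
            (measurable_pi_apply _)))
      = Var[fun x : ℕ → Ω => (∑ n ∈ range (b * a), f (x n)) / ((b * a : ℕ) : ℝ);
          Kernel.trajMeasure (X := fun _ : ℕ => Ω) π
            (fun n : ℕ => κ.comap (fun h : (i : ↥(Finset.Iic n)) → Ω => h ⟨n, Finset.mem_Iic.2 le_rfl⟩)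
              (measurable_pi_apply _))]
        - 2 * autocov κ π (fun y => f y - ∫ z, f z ∂π) 0 / (b * (a - 1))
          * (tauIntN (fun t => autocov κ π (fun y => f y - ∫ z, f z ∂π) t
                / autocov κ π (fun y => f y - ∫ z, f z ∂π) 0) (b * a)
             - tauIntN (fun t => autocov κ π (fun y => f y - ∫ z, f z ∂π) t
                / autocov κ π (fun y => f y - ∫ z, f z ∂π) 0) b) := by
  refine integral_batchSEsq_eq (X := fun n (x : ℕ → Ω) => f (x n)) ha hb
    (fun n _ => chain_memLp π hf hC n) _ _ (div_self hvar) (fun n _ n' _ => ?_)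
    (m := ∫ z, f z ∂π) (fun n _ => chain_marginal hπ n hf hC)
  rw [chain_covariance hπ hf hC n n', mul_div_cancel₀ _ hvar]

/-- **ANTI-CONSERVATIVE AT EVERY BIN SIZE FOR A POSITIVE KERNEL.**  If every stationary
autocovariance of the centred observable is nonnegative, `autocov κ π (f − πf) t ≥ 0`, then for
every `a ≥ 2` and `b ≥ 1` the expected batch-means error bar is at most the true variance of the
time average: `E[SE²_BM] ≤ Var(x̄_{ab})` (degenerate observables included). -/
theorem chain_integral_batchSEsq_le_variance (hπ : Kernel.Invariant κ π) {f : Ω → ℝ}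
    (hf : Measurable f) {C : ℝ} (hC : ∀ x, |f x| ≤ C)
    (hpos : ∀ t, 0 ≤ autocov κ π (fun y => f y - ∫ z, f z ∂π) t) {a b : ℕ} (ha : 2 ≤ a)
    (hb : b ≠ 0) :
    ∫ x, replicaSEsq (fun j (x : ℕ → Ω) => (∑ i ∈ range b, f (x (b * j + i))) / b) a x
        ∂(Kernel.trajMeasure (X := fun _ : ℕ => Ω) π
          (fun n : ℕ => κ.comap (fun h : (i : ↥(Finset.Iic n)) → Ω => h ⟨n, Finset.mem_Iic.2 le_rfl⟩)
            (measurable_pi_apply _)))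
      ≤ Var[fun x : ℕ → Ω => (∑ n ∈ range (b * a), f (x n)) / ((b * a : ℕ) : ℝ);
          Kernel.trajMeasure (X := fun _ : ℕ => Ω) π
            (fun n : ℕ => κ.comap (fun h : (i : ↥(Finset.Iic n)) → Ω => h ⟨n, Finset.mem_Iic.2 le_rfl⟩)
              (measurable_pi_apply _))] := by
  set g := fun y => f y - ∫ z, f z ∂π with hg
  have hgm : Measurable g := hf.sub measurable_const
  have hgb : ∀ y, |g y| ≤ C + |∫ z, f z ∂π| := fun y =>
    (abs_sub _ _).trans (add_le_add (hC y) le_rfl)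
  have hσ : 0 ≤ autocov κ π g 0 := hpos 0
  rcases hσ.eq_or_lt with hz | hσpos
  · -- degenerate observable: all covariances vanish, take `ρ = 1_{t = 0}`
    have hzero : ∀ t, autocov κ π g t = 0 := autocov_eq_zero_of_autocov_zero hπ hgm hgb hz.symm
    refine integral_batchSEsq_le_variance (X := fun n (x : ℕ → Ω) => f (x n)) ha hb
      (fun n _ => chain_memLp π hf hC n) (σ2 := 0) le_rfl
      (ρ := fun t => if t = 0 then 1 else 0) (if_pos rfl)
      (fun t => by split_ifs <;> norm_num) (fun n _ n' _ => ?_)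
      (m := ∫ z, f z ∂π) (fun n _ => chain_marginal hπ n hf hC)
    rw [chain_covariance hπ hf hC n n', hzero, zero_mul]
  · refine integral_batchSEsq_le_variance (X := fun n (x : ℕ → Ω) => f (x n)) ha hb
      (fun n _ => chain_memLp π hf hC n) hσ
      (ρ := fun t => autocov κ π g t / autocov κ π g 0) (div_self hσpos.ne')
      (fun t => div_nonneg (hpos t) hσ) (fun n _ n' _ => ?_)
      (m := ∫ z, f z ∂π) (fun n _ => chain_marginal hπ n hf hC)
    rw [chain_covariance hπ hf hC n n', mul_div_cancel₀ _ hσpos.ne']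

/-- **CERTIFIED BIAS UNDER A DOEBLIN MINORISATION.**  If `κ(x, ·) ≥ ε π` for every `x` with
`0 < ε`, then for every bounded measurable `f`, `a ≥ 2`, `b ≥ 1`, with `σ² = Var_π f`:
`|E[SE²_BM] − Var(x̄_{ab})| ≤ (2σ²/(b(a−1))) ((1−ε)/(b ε²) + (1−ε)^{b+1}/ε)`. -/
theorem chain_abs_integral_batchSEsq_sub_variance_le_of_doeblin (hπ : Kernel.Invariant κ π)
    {ε : ℝ≥0∞} (hmin : ∀ x {B : Set Ω}, MeasurableSet B → ε * π B ≤ κ x B) (hε0 : 0 < ε)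
    {f : Ω → ℝ} (hf : Measurable f) {C : ℝ} (hC : ∀ x, |f x| ≤ C) {a b : ℕ} (ha : 2 ≤ a)
    (hb : b ≠ 0) :
    |∫ x, replicaSEsq (fun j (x : ℕ → Ω) => (∑ i ∈ range b, f (x (b * j + i))) / b) a x
          ∂(Kernel.trajMeasure (X := fun _ : ℕ => Ω) π
            (fun n : ℕ => κ.comap (fun h : (i : ↥(Finset.Iic n)) → Ω => h ⟨n, Finset.mem_Iic.2 le_rfl⟩)
              (measurable_pi_apply _)))
        - Var[fun x : ℕ → Ω => (∑ n ∈ range (b * a), f (x n)) / ((b * a : ℕ) : ℝ);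
            Kernel.trajMeasure (X := fun _ : ℕ => Ω) π
              (fun n : ℕ => κ.comap
                (fun h : (i : ↥(Finset.Iic n)) → Ω => h ⟨n, Finset.mem_Iic.2 le_rfl⟩)
                (measurable_pi_apply _))]|
      ≤ 2 * autocov κ π (fun y => f y - ∫ z, f z ∂π) 0 / (b * (a - 1))
          * ((1 - ε.toReal) / (b * ε.toReal ^ 2) + (1 - ε.toReal) ^ (b + 1) / ε.toReal) := by
  set g := fun y => f y - ∫ z, f z ∂π with hg
  have hgm : Measurable g := hf.sub measurable_const
  have hgb : ∀ y, |g y| ≤ C + |∫ z, f z ∂π| := fun y =>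
    (abs_sub _ _).trans (add_le_add (hC y) le_rfl)
  have hg0 : ∫ y, g y ∂π = 0 := by
    simp only [hg]
    rw [integral_sub (integrable_of_bounded π hf hC) (integrable_const _), integral_const,
      probReal_univ, one_smul, sub_self]
  have hε1 : ε ≤ 1 := eps_le_one_of_doeblin hmin
  have hεtop : ε ≠ ⊤ := ne_top_of_le_ne_top ENNReal.one_ne_top hε1
  have hr0 : 0 ≤ 1 - ε.toReal := one_sub_toReal_nonneg_of_doeblin hmin
  have hεpos : 0 < ε.toReal := ENNReal.toReal_pos hε0.ne' hεtop
  have hr1 : 1 - ε.toReal < 1 := by linarith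
  have hσ : 0 ≤ autocov κ π g 0 := by
    rw [autocov_zero]; exact integral_nonneg fun _ => sq_nonneg _
  -- `1 − r = ε`, so the envelope constant reads through `ε`
  have hRHS : (1 - ε.toReal) / (b * ε.toReal ^ 2) + (1 - ε.toReal) ^ (b + 1) / ε.toReal
      = 1 * ((1 - ε.toReal) / (b * (1 - (1 - ε.toReal)) ^ 2)
          + (1 - ε.toReal) ^ (b + 1) / (1 - (1 - ε.toReal))) := by
    rw [sub_sub_cancel, one_mul]
  rcases hσ.eq_or_lt with hz | hσpos
  · -- degenerate observable: both sides vanish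
    have hzero : ∀ t, autocov κ π g t = 0 := autocov_eq_zero_of_autocov_zero hπ hgm hgb hz.symm
    have hE := integral_batchSEsq_eq (X := fun n (x : ℕ → Ω) => f (x n))
      (μ := Kernel.trajMeasure (X := fun _ : ℕ => Ω) π
        (fun n : ℕ => κ.comap (fun h : (i : ↥(Finset.Iic n)) → Ω => h ⟨n, Finset.mem_Iic.2 le_rfl⟩)
          (measurable_pi_apply _)))
      ha hb (fun n _ => chain_memLp π hf hC n) 0 (fun t => if t = 0 then 1 else 0) (if_pos rfl)
      (fun n _ n' _ => by rw [chain_covariance hπ hf hC n n', hzero, zero_mul])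
      (m := ∫ z, f z ∂π) (fun n _ => chain_marginal hπ n hf hC)
    rw [hE, ← hz]
    simp
  · rw [hRHS]
    exact abs_integral_batchSEsq_sub_variance_le (X := fun n (x : ℕ → Ω) => f (x n)) ha hb
      (fun n _ => chain_memLp π hf hC n) hσ (ρ := fun t => autocov κ π g t / autocov κ π g 0)
      (div_self hσpos.ne') zero_le_one hr0 hr1
      (fun t _ => by rw [one_mul]; exact abs_acf_le_of_doeblin hπ hmin hgm hgb hg0 t)
      (fun n _ n' _ => by rw [chain_covariance hπ hf hC n n', mul_div_cancel₀ _ hσpos.ne'])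
      (m := ∫ z, f z ∂π) (fun n _ => chain_marginal hπ n hf hC)

end Chain

/-! ### The exact independence-Metropolis flow sampler -/

section IMH

variable {q : Measure Ω} [IsProbabilityMeasure q] {w : Ω → ℝ} {π : Measure Ω}
  [IsProbabilityMeasure π]

/-- **THE FLOW SAMPLER'S BINNED ERROR BAR UNDER-COVERS IN EXPECTATION AT EVERY BIN SIZE.**  For
`K = indepMH q w` with `w · q = π` (the exact independence-Metropolis flow sampler, any model law
`q`), every bounded measurable `f`, every `a ≥ 2` batches of every length `b ≥ 1`, along the chain
started in `π`: `E[SE²_BM] ≤ Var[(1/(ab)) Σ_{n<ab} f(X_n)]` — the positivity hypothesis of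
`chain_integral_batchSEsq_le_variance` is the tree's `indepMH_autocov_nonneg`. -/
theorem indepMH_chain_integral_batchSEsq_le_variance (hw : Measurable w) (hw0 : ∀ x, 0 < w x)
    (hwi : Integrable w q) (hπ : (q.withDensity fun x => ENNReal.ofReal (w x)) = π)
    {f : Ω → ℝ} (hf : Measurable f) {C : ℝ} (hC : ∀ x, |f x| ≤ C) {a b : ℕ} (ha : 2 ≤ a)
    (hb : b ≠ 0) :
    haveI : Fact (Measurable w) := ⟨hw⟩
    ∫ x, replicaSEsq (fun j (x : ℕ → Ω) => (∑ i ∈ range b, f (x (b * j + i))) / b) a x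
        ∂(Kernel.trajMeasure (X := fun _ : ℕ => Ω) π
          (fun n : ℕ => (indepMH q w).comap
            (fun h : (i : ↥(Finset.Iic n)) → Ω => h ⟨n, Finset.mem_Iic.2 le_rfl⟩)
            (measurable_pi_apply _)))
      ≤ Var[fun x : ℕ → Ω => (∑ n ∈ range (b * a), f (x n)) / ((b * a : ℕ) : ℝ);
          Kernel.trajMeasure (X := fun _ : ℕ => Ω) π
            (fun n : ℕ => (indepMH q w).comap
              (fun h : (i : ↥(Finset.Iic n)) → Ω => h ⟨n, Finset.mem_Iic.2 le_rfl⟩)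
              (measurable_pi_apply _))] := by
  haveI : Fact (Measurable w) := ⟨hw⟩
  have hinv : Kernel.Invariant (indepMH q w) π := by rw [← hπ]; exact indepMH_invariant hw hw0
  exact chain_integral_batchSEsq_le_variance hinv hf hC
    (fun t => indepMH_autocov_nonneg hw hw0 hwi hπ (hf.sub measurable_const)
      (C := C + |∫ z, f z ∂π|) (fun y => (abs_sub _ _).trans (add_le_add (hC y) le_rfl)) t)
    ha hb

end IMH

end Summit.Ventures.LatticeQCDFlow.Scoring

end
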